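import Literature.Probability.RandomPlanarGeometry.SAWPulledLargeForceExpansionZdWordTypesSixBlocks
import HarnessLib

/-!
# The fibre census of the cost-8 length-10 layer, cells part 1 of 8: masks 1–3 of 23

Topic `Literature/Probability/RandomPlanarGeometry` («ZD-FOUR-SLACK-TWO (B)», cells).  For each block mask `m` (the `sameLevel` table of a
group of height words of `FourSlackTwo.verts`), the seven kernel cells `cnt m k` (ROBUST form of `…ZdWordTypesSixBlocks`: nested raw-letter
fold, one `decide +kernel` per cell, ≈ 8 s each) and the census of the class for every `d` in falling-factorial form (`card_good_eq`).  The
masks are this file's tool notions (not notions in print); the tables `sameLevel_p_q_r` identify them with `FourSlackTwo.sameLevel (p,q,r)`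
on the nine even blocks for the listed height words.  No number is taken from print. [cite: MadrasSlade1993, §4.2, remark after Theorem 4.2.4 (p. 94)]

Provenance: lane «pcv-sawmu», a-p3 g18 (2026-08-25); expected values from the exact type enumerator `axistypes.py` (FINDING (22)).
-/

open Finset
open scoped BigOperators
open Literature.Probability.LatticeModels
open Literature.Probability.RandomPlanarGeometry.SAW

namespace Literature.Probability.RandomPlanarGeometry.SAW.Zd

namespace WordTypes

/-- The nine even blocks, as a list (for the mask tables of this part). [cite: MadrasSlade1993, Definition 1.2.4] -/
def nineBlocks1 : List (ℕ × ℕ) := [(0, 2), (1, 3), (2, 4), (3, 5), (4, 6), (0, 4), (1, 5), (2, 6), (0, 6)]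

/-- Mask 1: blocks [(0, 2), (0, 4), (0, 6), (1, 3), (1, 5), (2, 4), (2, 6), (3, 5), (4, 6)]. [cite: MadrasSlade1993, §4.2, remark after Theorem 4.2.4 (p. 94)] -/
def mask1 : ℕ → ℕ → Bool
  | 0, 2 => true
  | 0, 4 => true
  | 0, 6 => true
  | 1, 3 => true
  | 1, 5 => true
  | 2, 4 => true
  | 2, 6 => true
  | 3, 5 => true
  | 4, 6 => true
  | _, _ => false

/-- `sameLevel (1,3,5)` is mask 1 on the nine even blocks. [cite: MadrasSlade1993, §4.2, remark after Theorem 4.2.4 (p. 94)] -/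
theorem sameLevel_1_3_5 : ∀ ij ∈ nineBlocks1, FourSlackTwo.sameLevel (1, 3, 5) ij.1 ij.2 = mask1 ij.1 ij.2 := by
  decide +kernel

/-- `sameLevel (1,3,9)` is mask 1 on the nine even blocks. [cite: MadrasSlade1993, §4.2, remark after Theorem 4.2.4 (p. 94)] -/
theorem sameLevel_1_3_9 : ∀ ij ∈ nineBlocks1, FourSlackTwo.sameLevel (1, 3, 9) ij.1 ij.2 = mask1 ij.1 ij.2 := by
  decide +kernel

/-- `sameLevel (1,4,6)` is mask 1 on the nine even blocks. [cite: MadrasSlade1993, §4.2, remark after Theorem 4.2.4 (p. 94)] -/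
theorem sameLevel_1_4_6 : ∀ ij ∈ nineBlocks1, FourSlackTwo.sameLevel (1, 4, 6) ij.1 ij.2 = mask1 ij.1 ij.2 := by
  decide +kernel

/-- `sameLevel (1,5,7)` is mask 1 on the nine even blocks. [cite: MadrasSlade1993, §4.2, remark after Theorem 4.2.4 (p. 94)] -/
theorem sameLevel_1_5_7 : ∀ ij ∈ nineBlocks1, FourSlackTwo.sameLevel (1, 5, 7) ij.1 ij.2 = mask1 ij.1 ij.2 := by
  decide +kernel

/-- `sameLevel (1,6,8)` is mask 1 on the nine even blocks. [cite: MadrasSlade1993, §4.2, remark after Theorem 4.2.4 (p. 94)] -/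
theorem sameLevel_1_6_8 : ∀ ij ∈ nineBlocks1, FourSlackTwo.sameLevel (1, 6, 8) ij.1 ij.2 = mask1 ij.1 ij.2 := by
  decide +kernel

/-- `sameLevel (1,7,9)` is mask 1 on the nine even blocks. [cite: MadrasSlade1993, §4.2, remark after Theorem 4.2.4 (p. 94)] -/
theorem sameLevel_1_7_9 : ∀ ij ∈ nineBlocks1, FourSlackTwo.sameLevel (1, 7, 9) ij.1 ij.2 = mask1 ij.1 ij.2 := by
  decide +kernel

/-- `sameLevel (2,4,9)` is mask 1 on the nine even blocks. [cite: MadrasSlade1993, §4.2, remark after Theorem 4.2.4 (p. 94)] -/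
theorem sameLevel_2_4_9 : ∀ ij ∈ nineBlocks1, FourSlackTwo.sameLevel (2, 4, 9) ij.1 ij.2 = mask1 ij.1 ij.2 := by
  decide +kernel

/-- `sameLevel (3,5,9)` is mask 1 on the nine even blocks. [cite: MadrasSlade1993, §4.2, remark after Theorem 4.2.4 (p. 94)] -/
theorem sameLevel_3_5_9 : ∀ ij ∈ nineBlocks1, FourSlackTwo.sameLevel (3, 5, 9) ij.1 ij.2 = mask1 ij.1 ij.2 := by
  decide +kernel

/-- `sameLevel (4,6,9)` is mask 1 on the nine even blocks. [cite: MadrasSlade1993, §4.2, remark after Theorem 4.2.4 (p. 94)] -/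
theorem sameLevel_4_6_9 : ∀ ij ∈ nineBlocks1, FourSlackTwo.sameLevel (4, 6, 9) ij.1 ij.2 = mask1 ij.1 ij.2 := by
  decide +kernel

/-- `sameLevel (5,7,9)` is mask 1 on the nine even blocks. [cite: MadrasSlade1993, §4.2, remark after Theorem 4.2.4 (p. 94)] -/
theorem sameLevel_5_7_9 : ∀ ij ∈ nineBlocks1, FourSlackTwo.sameLevel (5, 7, 9) ij.1 ij.2 = mask1 ij.1 ij.2 := by
  decide +kernel

/-- Cell: mask 1, `k = 0` → 0. [cite: MadrasSlade1993, §4.2, remark after Theorem 4.2.4 (p. 94)] -/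
theorem cnt_mask1_zero : cnt mask1 0 = 0 := by decide +kernel

/-- Cell: mask 1, `k = 1` → 2. [cite: MadrasSlade1993, §4.2, remark after Theorem 4.2.4 (p. 94)] -/
theorem cnt_mask1_one : cnt mask1 1 = 2 := by decide +kernel

/-- Cell: mask 1, `k = 2` → 388. [cite: MadrasSlade1993, §4.2, remark after Theorem 4.2.4 (p. 94)] -/
theorem cnt_mask1_two : cnt mask1 2 = 388 := by decide +kernel

/-- Cell: mask 1, `k = 3` → 2432. [cite: MadrasSlade1993, §4.2, remark after Theorem 4.2.4 (p. 94)] -/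
theorem cnt_mask1_three : cnt mask1 3 = 2432 := by decide +kernel

/-- Cell: mask 1, `k = 4` → 2672. [cite: MadrasSlade1993, §4.2, remark after Theorem 4.2.4 (p. 94)] -/
theorem cnt_mask1_four : cnt mask1 4 = 2672 := by decide +kernel

/-- Cell: mask 1, `k = 5` → 800. [cite: MadrasSlade1993, §4.2, remark after Theorem 4.2.4 (p. 94)] -/
theorem cnt_mask1_five : cnt mask1 5 = 800 := by decide +kernel

/-- Cell: mask 1, `k = 6` → 64. [cite: MadrasSlade1993, §4.2, remark after Theorem 4.2.4 (p. 94)] -/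
theorem cnt_mask1_six : cnt mask1 6 = 64 := by decide +kernel

/-- ★ Census of mask 1 for every `d` (10 height word(s) [(1, 3, 5), (1, 3, 9), (1, 4, 6), (1, 5, 7), (1, 6, 8), (1, 7, 9), (2, 4, 9), (3, 5, 9), (4, 6, 9), (5, 7, 9)]): `n = [2, 388, 2432, 2672, 800, 64]` in `Σ_k n_k d^(k)`.
[cite: MadrasSlade1993, §4.2, remark after Theorem 4.2.4 (p. 94)] -/
theorem card_good_mask1 (d : ℕ) :
    (Finset.univ.filter fun u : Word 6 d => Good mask1 u).card = 2 * d.descFactorial 1 + 388 * d.descFactorial 2 + 2432 * d.descFactorial 3 + 2672 * d.descFactorial 4 + 800 * d.descFactorial 5 + 64 * d.descFactorial 6 := by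
  rw [card_good_eq]
  simp only [Finset.sum_range_succ, Finset.sum_range_zero, cnt_mask1_zero, cnt_mask1_one, cnt_mask1_two, cnt_mask1_three, cnt_mask1_four, cnt_mask1_five, cnt_mask1_six]
  ring

/-- Mask 2: blocks [(0, 2), (0, 4), (0, 6), (1, 3), (1, 5), (2, 4), (3, 5)]. [cite: MadrasSlade1993, §4.2, remark after Theorem 4.2.4 (p. 94)] -/
def mask2 : ℕ → ℕ → Bool
  | 0, 2 => true
  | 0, 4 => true
  | 0, 6 => true
  | 1, 3 => true
  | 1, 5 => true
  | 2, 4 => true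
  | 3, 5 => true
  | _, _ => false

/-- `sameLevel (1,3,8)` is mask 2 on the nine even blocks. [cite: MadrasSlade1993, §4.2, remark after Theorem 4.2.4 (p. 94)] -/
theorem sameLevel_1_3_8 : ∀ ij ∈ nineBlocks1, FourSlackTwo.sameLevel (1, 3, 8) ij.1 ij.2 = mask2 ij.1 ij.2 := by
  decide +kernel

/-- Cell: mask 2, `k = 0` → 0. [cite: MadrasSlade1993, §4.2, remark after Theorem 4.2.4 (p. 94)] -/
theorem cnt_mask2_zero : cnt mask2 0 = 0 := by decide +kernel

/-- Cell: mask 2, `k = 1` → 4. [cite: MadrasSlade1993, §4.2, remark after Theorem 4.2.4 (p. 94)] -/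
theorem cnt_mask2_one : cnt mask2 1 = 4 := by decide +kernel

/-- Cell: mask 2, `k = 2` → 552. [cite: MadrasSlade1993, §4.2, remark after Theorem 4.2.4 (p. 94)] -/
theorem cnt_mask2_two : cnt mask2 2 = 552 := by decide +kernel

/-- Cell: mask 2, `k = 3` → 2936. [cite: MadrasSlade1993, §4.2, remark after Theorem 4.2.4 (p. 94)] -/
theorem cnt_mask2_three : cnt mask2 3 = 2936 := by decide +kernel

/-- Cell: mask 2, `k = 4` → 2944. [cite: MadrasSlade1993, §4.2, remark after Theorem 4.2.4 (p. 94)] -/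
theorem cnt_mask2_four : cnt mask2 4 = 2944 := by decide +kernel

/-- Cell: mask 2, `k = 5` → 832. [cite: MadrasSlade1993, §4.2, remark after Theorem 4.2.4 (p. 94)] -/
theorem cnt_mask2_five : cnt mask2 5 = 832 := by decide +kernel

/-- Cell: mask 2, `k = 6` → 64. [cite: MadrasSlade1993, §4.2, remark after Theorem 4.2.4 (p. 94)] -/
theorem cnt_mask2_six : cnt mask2 6 = 64 := by decide +kernel

/-- ★ Census of mask 2 for every `d` (1 height word(s) [(1, 3, 8)]): `n = [4, 552, 2936, 2944, 832, 64]` in `Σ_k n_k d^(k)`.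
[cite: MadrasSlade1993, §4.2, remark after Theorem 4.2.4 (p. 94)] -/
theorem card_good_mask2 (d : ℕ) :
    (Finset.univ.filter fun u : Word 6 d => Good mask2 u).card = 4 * d.descFactorial 1 + 552 * d.descFactorial 2 + 2936 * d.descFactorial 3 + 2944 * d.descFactorial 4 + 832 * d.descFactorial 5 + 64 * d.descFactorial 6 := by
  rw [card_good_eq]
  simp only [Finset.sum_range_succ, Finset.sum_range_zero, cnt_mask2_zero, cnt_mask2_one, cnt_mask2_two, cnt_mask2_three, cnt_mask2_four, cnt_mask2_five, cnt_mask2_six]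
  ring

/-- Mask 3: blocks [(0, 2), (0, 4), (0, 6), (1, 3), (1, 5), (2, 4), (4, 6)]. [cite: MadrasSlade1993, §4.2, remark after Theorem 4.2.4 (p. 94)] -/
def mask3 : ℕ → ℕ → Bool
  | 0, 2 => true
  | 0, 4 => true
  | 0, 6 => true
  | 1, 3 => true
  | 1, 5 => true
  | 2, 4 => true
  | 4, 6 => true
  | _, _ => false

/-- `sameLevel (1,3,7)` is mask 3 on the nine even blocks. [cite: MadrasSlade1993, §4.2, remark after Theorem 4.2.4 (p. 94)] -/
theorem sameLevel_1_3_7 : ∀ ij ∈ nineBlocks1, FourSlackTwo.sameLevel (1, 3, 7) ij.1 ij.2 = mask3 ij.1 ij.2 := by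
  decide +kernel

/-- Cell: mask 3, `k = 0` → 0. [cite: MadrasSlade1993, §4.2, remark after Theorem 4.2.4 (p. 94)] -/
theorem cnt_mask3_zero : cnt mask3 0 = 0 := by decide +kernel

/-- Cell: mask 3, `k = 1` → 4. [cite: MadrasSlade1993, §4.2, remark after Theorem 4.2.4 (p. 94)] -/
theorem cnt_mask3_one : cnt mask3 1 = 4 := by decide +kernel

/-- Cell: mask 3, `k = 2` → 552. [cite: MadrasSlade1993, §4.2, remark after Theorem 4.2.4 (p. 94)] -/
theorem cnt_mask3_two : cnt mask3 2 = 552 := by decide +kernel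

/-- Cell: mask 3, `k = 3` → 2936. [cite: MadrasSlade1993, §4.2, remark after Theorem 4.2.4 (p. 94)] -/
theorem cnt_mask3_three : cnt mask3 3 = 2936 := by decide +kernel

/-- Cell: mask 3, `k = 4` → 2944. [cite: MadrasSlade1993, §4.2, remark after Theorem 4.2.4 (p. 94)] -/
theorem cnt_mask3_four : cnt mask3 4 = 2944 := by decide +kernel

/-- Cell: mask 3, `k = 5` → 832. [cite: MadrasSlade1993, §4.2, remark after Theorem 4.2.4 (p. 94)] -/
theorem cnt_mask3_five : cnt mask3 5 = 832 := by decide +kernel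

/-- Cell: mask 3, `k = 6` → 64. [cite: MadrasSlade1993, §4.2, remark after Theorem 4.2.4 (p. 94)] -/
theorem cnt_mask3_six : cnt mask3 6 = 64 := by decide +kernel

/-- ★ Census of mask 3 for every `d` (1 height word(s) [(1, 3, 7)]): `n = [4, 552, 2936, 2944, 832, 64]` in `Σ_k n_k d^(k)`.
[cite: MadrasSlade1993, §4.2, remark after Theorem 4.2.4 (p. 94)] -/
theorem card_good_mask3 (d : ℕ) :
    (Finset.univ.filter fun u : Word 6 d => Good mask3 u).card = 4 * d.descFactorial 1 + 552 * d.descFactorial 2 + 2936 * d.descFactorial 3 + 2944 * d.descFactorial 4 + 832 * d.descFactorial 5 + 64 * d.descFactorial 6 := by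
  rw [card_good_eq]
  simp only [Finset.sum_range_succ, Finset.sum_range_zero, cnt_mask3_zero, cnt_mask3_one, cnt_mask3_two, cnt_mask3_three, cnt_mask3_four, cnt_mask3_five, cnt_mask3_six]
  ring

end WordTypes

end Literature.Probability.RandomPlanarGeometry.SAW.Zd
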